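import Summits.QuantumFields.YangMills.Theorems.SourcedPressureJensenSourcedPressureIncrementGaussSecondCumulant
import Summits.QuantumFields.YangMills.Theorems.SourcedPressureJensenSourcedPressureIncrementUniformStability
import Summits.QuantumFields.YangMills.Theorems.SourcedPressureJensenSourcedPressureIncrementCgfWindowMoments
import Literature.Probability.Distributions.GaussianHypercontractivity
import HarnessLib

/-!
# `SourcedPressureIncrement` (stmt-QuantumFields-22517), line `birth`: HYPERCONTRACTIVITY for polynomials of the curvature Gaussian
# field, the sharp fourth moment of the centred source, and the Gaussian sourced increment in the window with remainder `M·h²·|B|`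

Helper toward the deciding crux stmt-QuantumFields-22517 (`SourcedPressureJensen.SourcedPressureIncrement`; free-cell children
KS1′ stmt-QuantumFields-23996 / KS2′ stmt-QuantumFields-24028).  `γ = curvatureGaussianField d D`; `H_B = Σ_{x∈B} A_xA_{x+ne₀}` the
source of `gaussIncrement` (`d = 4`), `E_γH_B = |B|(λ²D/2)C(n)²` (`gauss_firstCumulant_sum`), `Var_γH_B ≤ M₂|B|` (`gauss_secondCumulant_le`).

* `gaussian_bonami_gaussianFieldOfKernel`, **`gaussian_bonami_curvatureGaussianField`** — Nelson/Bonami hypercontractivity for the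
  field of a positive semidefinite kernel and for the curvature field: for a finite index set `I`, a polynomial `P` in the variables
  `I` of total degree `≤ k` and `r ≥ 1`, `∫ P(Y|_I)^{2r} dγ ≤ (2r−1)^{rk} (∫ P(Y|_I)² dγ)^r` (the tree's
  `gaussian_bonami_multivariateGaussian` transported through the marginal `gaussianFieldOfKernel_map_restrict` and the currying of
  `curvatureGaussianField`) — the `L^{2r} ≤ C·L²` control of Wick polynomials of the free lattice field strength;
* **`integral_centredSource_pow_four_le_sq`** — `E_γ[(H_B − EH_B)⁴] ≤ 3⁸·(Var_γ H_B)²` (`H_B − EH_B` is a polynomial of degree `4` in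
  the `2|B|D` touched plaquette variables), hence `≤ 3⁸M₂²|B|²`;
* **`gauss_increment_window_card`** — there are `M ≥ 0`, `h₀ > 0` (depending on `D, λ`) with: for every separation `n`, finite
  `B ⊂ ℤ⁴` and `0 < h`, `h·|B| ≤ h₀`:  `log E_γ exp(−hH_B) ≤ −h·|B|·(λ²D/2)·C(n)² + M·h²·|B|`, i.e. per site
  `gaussIncrement ≤ −hσC(n)² + M·h²` IN THE WINDOW — the form of the ideator's `stub_gauss` (whose `∀ h ≤ h₀` version needs a tilted
  cluster expansion, the line's wall per the lead's note on 23996), sharpening `gauss_increment_window_sq_card` (`…GaussIncrementWindow`,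
  `M h²|B|²`) and w3's `gauss_increment_window` (`…GaussWindowBound`, `K h²(|B|+1)⁴`).  Ingredients: `log_integral_exp_neg_mul_le_of_moments`
  (`…CgfWindowMoments`), the variance and fourth-moment bounds above, and the volume-uniform ceiling `gauss_increment_jensen_uniform`
  (`…UniformStability`) for `∫e^{−2hZ} ≤ E₀` in the window.

RECORD-label rung support (all-`G` leaf `WeakCouplingRates.XiPow`); the Yang–Mills mass gap is NOT proved by anything here.  Sources:
S. Janson, *Gaussian Hilbert Spaces* (1997) Thm. 5.10 (Nelson), Thm 1.28; L. Gross (1975) §4. [folklore]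
-/

noncomputable section

open MeasureTheory ProbabilityTheory
open Literature.Probability.Distributions
open Literature.MathematicalPhysics.QuantumFieldTheory Literature.MathematicalPhysics.QuantumLattice
open Literature.Probability.LatticeModels Literature.Barriers.CriticalPhenomena

namespace Summit.QuantumFields.YangMills.Cruxes.SourcedPressureIncrement.Birth

/-! ### §1 Bonami–Nelson–Gross for the Gaussian field of a kernel and for the curvature field -/

section Kernel

variable {ι : Type*} [DecidableEq ι] {K : ι → ι → ℝ}

/-- **Gaussian hypercontractivity for the field of a positive semidefinite kernel**: for a finite set `I` of indices, a real
polynomial `P` in the variables `I` of total degree `≤ d`, and `r ≥ 1`,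
`∫ P(ω|_I)^{2r} dμ_K ≤ (2r − 1)^{rd} (∫ P(ω|_I)² dμ_K)^r` — the tree's `gaussian_bonami_multivariateGaussian` transported through
the finite-dimensional marginal `gaussianFieldOfKernel_map_restrict`. [cite: Janson1997, Thm. 5.10] -/
theorem gaussian_bonami_gaussianFieldOfKernel (hK : IsPosSemidefKernel K) (I : Finset ι) (d : ℕ) (P : MvPolynomial I ℝ)
    (hP : P.totalDegree ≤ d) (r : ℕ) (hr : 1 ≤ r) :
    ∫ ω, (MvPolynomial.eval (fun i : I => ω i) P) ^ (2 * r) ∂gaussianFieldOfKernel K ≤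
      (2 * r - 1 : ℝ) ^ (r * d) * (∫ ω, (MvPolynomial.eval (fun i : I => ω i) P) ^ 2 ∂gaussianFieldOfKernel K) ^ r := by
  have htr : ∀ q : ℕ, ∫ ω, (MvPolynomial.eval (fun i : I => ω i) P) ^ q ∂gaussianFieldOfKernel K =
      ∫ x, (MvPolynomial.eval (WithLp.ofLp x) P) ^ q ∂multivariateGaussian 0 (covGram K I) := by
    intro q
    have hc : Continuous fun y : I → ℝ => (MvPolynomial.eval y P) ^ q := (MvPolynomial.continuous_eval P).pow q
    have h1 : ∫ ω, (MvPolynomial.eval (fun i : I => ω i) P) ^ q ∂gaussianFieldOfKernel K =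
        ∫ y, (MvPolynomial.eval y P) ^ q ∂((gaussianFieldOfKernel K).map I.restrict) := by
      rw [integral_map (Finset.measurable_restrict I).aemeasurable hc.aestronglyMeasurable]
      rfl
    rw [h1, gaussianFieldOfKernel_map_restrict hK I, integral_gaussianFamilyOfKernel]
  rw [htr, htr]
  exact gaussian_bonami_multivariateGaussian (covGram K I) d P hP r hr

end Kernel

section Curvature

variable {d : ℕ}

/-- **Gaussian hypercontractivity for the curvature field**: for a finite set `I` of (plaquette, colour) indices, a polynomial
`P` in the variables `I` of total degree `≤ k` and `r ≥ 1`: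
`∫ P(Y|_I)^{2r} dγ ≤ (2r − 1)^{rk} (∫ P(Y|_I)² dγ)^r`, `γ = curvatureGaussianField d D` (`d ≥ 3`).  Nelson's inequality for
Wick polynomials of the free lattice field strength. [cite: Janson1997, Thm. 5.10] -/
theorem gaussian_bonami_curvatureGaussianField (hd : 3 ≤ d) (D : ℕ) (I : Finset (ZdPlaquette d × Fin D)) (k : ℕ)
    (P : MvPolynomial I ℝ) (hP : P.totalDegree ≤ k) (r : ℕ) (hr : 1 ≤ r) :
    ∫ Y, (MvPolynomial.eval (fun i : I => Y (i : ZdPlaquette d × Fin D).1 (i : ZdPlaquette d × Fin D).2) P) ^ (2 * r)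
        ∂curvatureGaussianField d D ≤
      (2 * r - 1 : ℝ) ^ (r * k) *
        (∫ Y, (MvPolynomial.eval (fun i : I => Y (i : ZdPlaquette d × Fin D).1 (i : ZdPlaquette d × Fin D).2) P) ^ 2
          ∂curvatureGaussianField d D) ^ r := by
  rw [integral_curvatureGaussianField_eq, integral_curvatureGaussianField_eq]
  exact gaussian_bonami_gaussianFieldOfKernel (isPosSemidefKernel_curvatureCovKernel hd D) I k P hP r hr

end Curvature

/-! ### §2 The centred Gaussian source is a degree-4 polynomial in finitely many plaquette variables: sharp fourth moment -/

section Source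

open scoped Nat

/-- **SHARP FOURTH CENTRAL MOMENT OF THE GAUSSIAN SOURCE (hypercontractivity)**: for every separation `n` and finite `B ⊂ ℤ⁴`,
`E_γ[(H_B − |B|·(λ²D/2)C(n)²)⁴] ≤ 3⁸ · (E_γ[(H_B − |B|·(λ²D/2)C(n)²)²])²` — `H_B − EH_B` is a polynomial of total degree `4` in the
plaquette variables touched by `B` (Nelson/Bonami with `q = 4`: `‖Z‖₄ ≤ 3²‖Z‖₂`).  With `gauss_secondCumulant_le` this is
`≤ 3⁸M₂²|B|²` — linear scaling of `(E Z⁴)^{1/2}` in the volume, replacing the crude `|B|²` of `…GaussSourceMoments`.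
[cite: Janson1997, Thm. 5.10] -/
theorem integral_centredSource_pow_four_le_sq (D : ℕ) (lam : ℝ) (n : ℕ) (B : Finset (Site 4)) :
    Integrable (fun Y : ZdPlaquette 4 → Fin D → ℝ => (∑ x ∈ B,
            (lam / 2 * (∑ a : Fin D, (Y (plaquette12 (d := 4) (by norm_num) x) a) ^ 2) -
                lam / 2 * D * curvaturePlaquetteCorr (d := 4) (by norm_num) 0) *
              (lam / 2 * (∑ a : Fin D, (Y (plaquette12 (d := 4) (by norm_num) (x + Pi.single (0 : Fin 4) (n : ℤ))) a) ^ 2) -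
                lam / 2 * D * curvaturePlaquetteCorr (d := 4) (by norm_num) 0) -
          (B.card : ℝ) * (lam ^ 2 * D / 2 * (curvaturePlaquetteCorr (d := 4) (by norm_num) (n : ℤ)) ^ 2)) ^ 4)
      (curvatureGaussianField (d := 4) D) ∧
    ∫ Y, (∑ x ∈ B,
            (lam / 2 * (∑ a : Fin D, (Y (plaquette12 (d := 4) (by norm_num) x) a) ^ 2) -
                lam / 2 * D * curvaturePlaquetteCorr (d := 4) (by norm_num) 0) *
              (lam / 2 * (∑ a : Fin D, (Y (plaquette12 (d := 4) (by norm_num) (x + Pi.single (0 : Fin 4) (n : ℤ))) a) ^ 2) -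
                lam / 2 * D * curvaturePlaquetteCorr (d := 4) (by norm_num) 0) -
          (B.card : ℝ) * (lam ^ 2 * D / 2 * (curvaturePlaquetteCorr (d := 4) (by norm_num) (n : ℤ)) ^ 2)) ^ 4
        ∂curvatureGaussianField (d := 4) D ≤
      3 ^ 8 * (∫ Y, (∑ x ∈ B,
            (lam / 2 * (∑ a : Fin D, (Y (plaquette12 (d := 4) (by norm_num) x) a) ^ 2) -
                lam / 2 * D * curvaturePlaquetteCorr (d := 4) (by norm_num) 0) *
              (lam / 2 * (∑ a : Fin D, (Y (plaquette12 (d := 4) (by norm_num) (x + Pi.single (0 : Fin 4) (n : ℤ))) a) ^ 2) -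
                lam / 2 * D * curvaturePlaquetteCorr (d := 4) (by norm_num) 0) -
          (B.card : ℝ) * (lam ^ 2 * D / 2 * (curvaturePlaquetteCorr (d := 4) (by norm_num) (n : ℤ)) ^ 2)) ^ 2
        ∂curvatureGaussianField (d := 4) D) ^ 2 := by
  have hd : 3 ≤ 4 := by norm_num
  set γ := curvatureGaussianField (d := 4) D with hγ
  have hX := isGaussianProcess_eval_curvatureGaussianField (d := 4) hd D
  set v : Site 4 := Pi.single (0 : Fin 4) (n : ℤ) with hv
  set C0 : ℝ := curvaturePlaquetteCorr (d := 4) hd 0 with hC0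
  set mB : ℝ := (B.card : ℝ) * (lam ^ 2 * D / 2 * (curvaturePlaquetteCorr (d := 4) hd (n : ℤ)) ^ 2) with hmB
  -- the touched indices and the polynomial
  set I : Finset (ZdPlaquette 4 × Fin D) :=
    (B.image (plaquette12 (d := 4) hd) ∪ B.image (fun x => plaquette12 (d := 4) hd (x + v))) ×ˢ
      (Finset.univ : Finset (Fin D)) with hI
  have hm1 : ∀ x ∈ B, ∀ a : Fin D, (plaquette12 (d := 4) hd x, a) ∈ I := fun x hx a =>
    Finset.mem_product.2 ⟨Finset.mem_union_left _ (Finset.mem_image_of_mem _ hx), Finset.mem_univ a⟩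
  have hm2 : ∀ x ∈ B, ∀ a : Fin D, (plaquette12 (d := 4) hd (x + v), a) ∈ I := fun x hx a =>
    Finset.mem_product.2 ⟨Finset.mem_union_right _ (Finset.mem_image_of_mem (fun x => plaquette12 (d := 4) hd (x + v)) hx),
      Finset.mem_univ a⟩
  set Q : B → MvPolynomial I ℝ := fun x =>
    (MvPolynomial.C (lam / 2) * (∑ a : Fin D, MvPolynomial.X (⟨(plaquette12 (d := 4) hd x, a), hm1 x x.2 a⟩ : I) ^ 2) -
        MvPolynomial.C (lam / 2 * D * C0)) *
      (MvPolynomial.C (lam / 2) * (∑ a : Fin D, MvPolynomial.X (⟨(plaquette12 (d := 4) hd (x + v), a), hm2 x x.2 a⟩ : I) ^ 2) -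
        MvPolynomial.C (lam / 2 * D * C0)) with hQ
  set P : MvPolynomial I ℝ := (∑ x ∈ B.attach, Q x) - MvPolynomial.C mB with hP
  -- evaluation = the centred source
  have heval : ∀ Y : ZdPlaquette 4 → Fin D → ℝ,
      MvPolynomial.eval (fun i : I => Y (i : ZdPlaquette 4 × Fin D).1 (i : ZdPlaquette 4 × Fin D).2) P =
        (∑ x ∈ B, (lam / 2 * (∑ a : Fin D, (Y (plaquette12 (d := 4) hd x) a) ^ 2) - lam / 2 * D * C0) *
            (lam / 2 * (∑ a : Fin D, (Y (plaquette12 (d := 4) hd (x + v)) a) ^ 2) - lam / 2 * D * C0)) - mB := by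
    intro Y
    simp only [hP, hQ, map_sub, map_sum, map_mul, map_pow, MvPolynomial.eval_C, MvPolynomial.eval_X]
    rw [Finset.sum_attach B fun x => (lam / 2 * (∑ a : Fin D, (Y (plaquette12 (d := 4) hd x) a) ^ 2) - lam / 2 * D * C0) *
      (lam / 2 * (∑ a : Fin D, (Y (plaquette12 (d := 4) hd (x + v)) a) ^ 2) - lam / 2 * D * C0)]
  -- total degree ≤ 4
  have hdegS : ∀ (f : Fin D → I), (∑ a : Fin D, (MvPolynomial.X (f a) : MvPolynomial I ℝ) ^ 2).totalDegree ≤ 2 :=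
    fun f => MvPolynomial.totalDegree_finsetSum_le fun a _ => (MvPolynomial.totalDegree_X_pow _ 2).le
  have hdegF : ∀ (f : Fin D → I) (c c' : ℝ),
      (MvPolynomial.C c * (∑ a : Fin D, (MvPolynomial.X (f a) : MvPolynomial I ℝ) ^ 2) - MvPolynomial.C c').totalDegree ≤ 2 := by
    intro f c c'
    refine (MvPolynomial.totalDegree_sub _ _).trans (max_le ?_ (by rw [MvPolynomial.totalDegree_C]; norm_num))
    refine (MvPolynomial.totalDegree_mul _ _).trans ?_
    rw [MvPolynomial.totalDegree_C, zero_add]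
    exact hdegS f
  have hdegQ : ∀ x : B, (Q x).totalDegree ≤ 4 := fun x =>
    (MvPolynomial.totalDegree_mul _ _).trans (add_le_add (hdegF _ _ _) (hdegF _ _ _))
  have hdeg : P.totalDegree ≤ 4 := by
    refine (MvPolynomial.totalDegree_sub _ _).trans (max_le ?_ (by rw [MvPolynomial.totalDegree_C]; norm_num))
    exact MvPolynomial.totalDegree_finsetSum_le fun x _ => hdegQ x
  -- integrability (a polynomial) and Bonami with `r = 2`
  have hint : Integrable (fun Y : ZdPlaquette 4 → Fin D → ℝ =>
      (MvPolynomial.eval (fun i : I => Y (i : ZdPlaquette 4 × Fin D).1 (i : ZdPlaquette 4 × Fin D).2) P) ^ 4) γ := by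
    have h := integrable_mvPolynomial_eval hX (fun i : I => (i : ZdPlaquette 4 × Fin D)) (P ^ 4)
    simpa only [map_pow] using h
  have hB := gaussian_bonami_curvatureGaussianField (d := 4) hd D I 4 P hdeg 2 (by norm_num)
  simp only [heval] at hint hB
  refine ⟨hint, ?_⟩
  have e4 : (2 * 2 : ℕ) = 4 := by norm_num
  rw [e4] at hB
  refine hB.trans (le_of_eq ?_)
  norm_num
  rfl

end Source

/-! ### §3 The Gaussian sourced increment in the window, remainder LINEAR in the volume -/

section Window

open scoped Nat

/-- **THE GAUSSIAN SOURCED INCREMENT IN THE WINDOW `h·|B| ≤ h₀`, remainder `M·h²·|B|` (per site `M·h²`).**  For every colour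
number `D` and scale `λ ≥ 0` there are `M ≥ 0`, `h₀ > 0` such that for every separation `n`, finite `B ⊂ ℤ⁴` and `0 < h` with
`h·|B| ≤ h₀`:
`log E_γ exp(−h Σ_{x∈B} A_xA_{x+ne₀}) ≤ −h·|B|·(λ²D/2)·C(n)² + M·h²·|B|`
— in the window the Gaussian sourced increment per site is its first cumulant up to `M h²`, the form of the ideator's `stub_gauss`
(whose `∀ h ≤ h₀` version needs a tilted-measure cluster expansion).  As `gauss_increment_window_sq_card` (`…GaussIncrementWindow`)
but with the hypercontractive fourth moment `integral_centredSource_pow_four_le_sq` in place of the crude one. [cite: Janson1997, Thm. 5.10] -/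
theorem gauss_increment_window_card (D : ℕ) {lam : ℝ} (hlam : 0 ≤ lam) :
    ∃ M h₀ : ℝ, 0 ≤ M ∧ 0 < h₀ ∧ ∀ (n : ℕ) (B : Finset (Site 4)) (h : ℝ), 0 < h → h * B.card ≤ h₀ →
      Real.log (∫ Y, Real.exp (-h * ∑ x ∈ B,
          (lam / 2 * (∑ a : Fin D, (Y (plaquette12 (d := 4) (by norm_num) x) a) ^ 2) -
              lam / 2 * D * curvaturePlaquetteCorr (d := 4) (by norm_num) 0) *
            (lam / 2 * (∑ a : Fin D, (Y (plaquette12 (d := 4) (by norm_num) (x + Pi.single (0 : Fin 4) (n : ℤ))) a) ^ 2) -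
              lam / 2 * D * curvaturePlaquetteCorr (d := 4) (by norm_num) 0))
          ∂curvatureGaussianField (d := 4) D) ≤
        -h * ((B.card : ℝ) * (lam ^ 2 * D / 2 * (curvaturePlaquetteCorr (d := 4) (by norm_num) (n : ℤ)) ^ 2)) +
          M * h ^ 2 * (B.card : ℝ) := by
  have hd : 3 ≤ 4 := by norm_num
  obtain ⟨M₂, hM₂0, hM₂⟩ := gauss_secondCumulant_le D lam
  obtain ⟨K, hK0, hK⟩ := exists_abs_curvatureTwoPoint_plaquette12_le
  set C0 : ℝ := curvaturePlaquetteCorr (d := 4) hd 0 with hC0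
  -- the constants (opaque; only their defining equations are used)
  obtain ⟨σ, hσ⟩ : ∃ σ : ℝ, σ = lam ^ 2 * D / 2 := ⟨_, rfl⟩
  have hσ0 : 0 ≤ σ := by rw [hσ]; positivity
  have hden : 0 < lam ^ 2 * D + 4 := by positivity
  obtain ⟨h₀, hh₀⟩ : ∃ h₀ : ℝ, h₀ = 1 / (2 * (lam ^ 2 * D + 4)) := ⟨_, rfl⟩
  have hh₀0 : 0 < h₀ := by rw [hh₀]; positivity
  obtain ⟨E₀, hE₀⟩ : ∃ E₀ : ℝ, E₀ = Real.exp (2 * h₀ * (σ * K ^ 2) + h₀ * (lam ^ 2 * D ^ 2)) := ⟨_, rfl⟩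
  have hE₀0 : 0 < E₀ := by rw [hE₀]; exact Real.exp_pos _
  obtain ⟨M, hM⟩ : ∃ M : ℝ, M = (M₂ + 81 * M₂ * E₀ ^ (1 / 2 : ℝ)) / 2 := ⟨_, rfl⟩
  have hM0 : 0 ≤ M := by
    rw [hM]
    exact div_nonneg (add_nonneg hM₂0 (mul_nonneg (mul_nonneg (by norm_num) hM₂0) (Real.rpow_nonneg hE₀0.le _)))
      zero_le_two
  refine ⟨M, h₀, hM0, hh₀0, fun n B h hh hwin => ?_⟩
  set γ := curvatureGaussianField (d := 4) D with hγ
  haveI := isProbabilityMeasure_curvatureGaussianField hd D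
  -- the empty box
  rcases B.eq_empty_or_nonempty with hB | hB
  · subst hB
    simp
  have hcard : (1 : ℝ) ≤ B.card := by exact_mod_cast Finset.card_pos.2 hB
  have hcard0 : (0 : ℝ) ≤ B.card := by positivity
  have hhB : h ≤ h * B.card := le_mul_of_one_le_right hh.le hcard
  have hh1 : h ≤ h₀ := hhB.trans hwin
  have hle1 : h ≤ 1 / (lam ^ 2 * D + 4) := by
    refine hh1.trans ?_
    rw [hh₀]
    exact one_div_le_one_div_of_le hden (by linarith)
  have hle2 : 2 * h ≤ 1 / (lam ^ 2 * D + 4) := by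
    have : 2 * h ≤ 2 * h₀ := by linarith
    refine this.trans (le_of_eq ?_)
    rw [hh₀]; field_simp
  -- the source, its mean, the centred source
  set v : Site 4 := Pi.single (0 : Fin 4) (n : ℤ) with hv
  set Cn : ℝ := curvaturePlaquetteCorr (d := 4) hd (n : ℤ) with hCn
  obtain ⟨m, hm⟩ : ∃ m : ℝ, m = σ * Cn ^ 2 := ⟨_, rfl⟩
  set H : (ZdPlaquette 4 → Fin D → ℝ) → ℝ := fun Y => ∑ x ∈ B,
      (lam / 2 * (∑ a : Fin D, (Y (plaquette12 (d := 4) hd x) a) ^ 2) - lam / 2 * D * C0) *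
        (lam / 2 * (∑ a : Fin D, (Y (plaquette12 (d := 4) hd (x + v)) a) ^ 2) - lam / 2 * D * C0) with hH
  set mB : ℝ := (B.card : ℝ) * (lam ^ 2 * D / 2 * Cn ^ 2) with hmB
  have hmBm : mB = B.card * m := by rw [hmB, hm, hσ]
  -- |C(n)| ≤ K, hence 0 ≤ m ≤ σ K²
  have hCnK : |Cn| ≤ K := by
    have h1 := hK 0 (0 + v)
    have h2 : (1 + euclidNorm ((0 : Site 4) - (0 + v))) ^ (-(4 : ℝ)) ≤ 1 :=
      Real.rpow_le_one_of_one_le_of_nonpos (by linarith [euclidNorm_nonneg ((0 : Site 4) - (0 + v))]) (by norm_num)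
    have h0f : (⟨0, by omega⟩ : Fin 4) = 0 := rfl
    have h3 : curvatureTwoPoint (plaquette12 (d := 4) hd 0) (plaquette12 (d := 4) hd (0 + v)) = Cn := by
      have h := curvatureTwoPoint_plaquette12_shift hd (0 : Site 4) (n : ℤ)
      rw [h0f] at h
      exact h
    rw [← h3]
    exact h1.trans (mul_le_of_le_one_right hK0 h2)
  have hm0 : 0 ≤ m := by rw [hm]; positivity
  have hmK : m ≤ σ * K ^ 2 := by
    rw [hm]
    refine mul_le_mul_of_nonneg_left ?_ hσ0
    calc Cn ^ 2 = |Cn| ^ 2 := (sq_abs _).symm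
      _ ≤ K ^ 2 := pow_le_pow_left₀ (abs_nonneg _) hCnK 2
  -- (i) mean and integrability of the source
  have hmean : ∫ Y, H Y ∂γ = mB := by
    have hfc := gauss_firstCumulant_sum D lam n B
    exact hfc
  have hH1 : Integrable H γ := by
    have hint := integrable_finsetSum B fun x _ => integrable_gauss_summand D lam n x
    exact hint
  -- (ii) the centred source and its moments (second: `gauss_secondCumulant_le`; fourth: hypercontractivity)
  have hZ0 : ∫ Y, (H Y - mB) ∂γ = 0 := by
    rw [integral_sub hH1 (integrable_const _), hmean, integral_const, probReal_univ, one_smul, sub_self]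
  have hZ1 : Integrable (fun Y => H Y - mB) γ := hH1.sub (integrable_const _)
  have hZ2le : ∫ Y, (H Y - mB) ^ 2 ∂γ ≤ M₂ * B.card := by
    have h2 := hM₂ n B
    exact h2
  obtain ⟨iZ4', hZ4'⟩ := integral_centredSource_pow_four_le_sq D lam n B
  have hZ4 : Integrable (fun Y => (H Y - mB) ^ 4) γ := by
    have h4 := iZ4'
    exact h4
  have hZ4le : ∫ Y, (H Y - mB) ^ 4 ∂γ ≤ (81 * M₂ * B.card) ^ 2 := by
    have h4 : ∫ Y, (H Y - mB) ^ 4 ∂γ ≤ 3 ^ 8 * (∫ Y, (H Y - mB) ^ 2 ∂γ) ^ 2 := by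
      have h4' := hZ4'
      exact h4'
    have hnn : 0 ≤ ∫ Y, (H Y - mB) ^ 2 ∂γ := integral_nonneg fun Y => sq_nonneg _
    have h5 : (∫ Y, (H Y - mB) ^ 2 ∂γ) ^ 2 ≤ (M₂ * B.card) ^ 2 := pow_le_pow_left₀ hnn hZ2le 2
    calc ∫ Y, (H Y - mB) ^ 4 ∂γ ≤ 3 ^ 8 * (∫ Y, (H Y - mB) ^ 2 ∂γ) ^ 2 := h4
      _ ≤ 3 ^ 8 * (M₂ * B.card) ^ 2 := mul_le_mul_of_nonneg_left h5 (by norm_num)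
      _ = (81 * M₂ * B.card) ^ 2 := by ring
  have hZ2 : Integrable (fun Y => (H Y - mB) ^ 2) γ := by
    refine ((integrable_const (1 : ℝ)).add hZ4).mono' ((hZ1.aestronglyMeasurable.pow 2)) (ae_of_all _ fun Y => ?_)
    rw [Real.norm_eq_abs, abs_of_nonneg (sq_nonneg _)]
    show (H Y - mB) ^ 2 ≤ 1 + (H Y - mB) ^ 4
    have hsq0 := sq_nonneg ((H Y - mB) ^ 2 - 1 / 2)
    have hid : 1 + (H Y - mB) ^ 4 - (H Y - mB) ^ 2 = ((H Y - mB) ^ 2 - 1 / 2) ^ 2 + 3 / 4 := by ring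
    linarith only [hid, hsq0]
  -- (iii) negative exponential moments, from the volume-uniform stability of `…UniformStability`
  obtain ⟨iE1', -, -⟩ := gauss_increment_jensen_uniform D hlam n B hh.le hle1
  obtain ⟨iE2', -, hceil2⟩ := gauss_increment_jensen_uniform D hlam n B (by positivity : (0 : ℝ) ≤ 2 * h) hle2
  have eE : ∀ (t : ℝ) (Y : ZdPlaquette 4 → Fin D → ℝ),
      Real.exp (-(t * (H Y - mB))) = Real.exp (t * mB) * Real.exp (-t * H Y) := by
    intro t Y; rw [← Real.exp_add]; ring_nf
  have hE1 : Integrable (fun Y => Real.exp (-(h * (H Y - mB)))) γ := by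
    have := iE1'.const_mul (Real.exp (h * mB))
    exact this.congr (ae_of_all _ fun Y => (eE h Y).symm)
  have hE2 : Integrable (fun Y => Real.exp (-(2 * h * (H Y - mB)))) γ := by
    have := iE2'.const_mul (Real.exp (2 * h * mB))
    exact this.congr (ae_of_all _ fun Y => (eE (2 * h) Y).symm)
  have hE2le : ∫ Y, Real.exp (-(2 * h * (H Y - mB))) ∂γ ≤ E₀ := by
    have e1 : ∫ Y, Real.exp (-(2 * h * (H Y - mB))) ∂γ = Real.exp (2 * h * mB) * ∫ Y, Real.exp (-(2 * h) * H Y) ∂γ := by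
      rw [← integral_const_mul]
      exact integral_congr_ae (ae_of_all _ fun Y => eE (2 * h) Y)
    have hpos : 0 < ∫ Y, Real.exp (-(2 * h) * H Y) ∂γ := integral_exp_pos iE2'
    have h2 : ∫ Y, Real.exp (-(2 * h) * H Y) ∂γ ≤ Real.exp (2 * h * (lam ^ 2 * D ^ 2 / 2) * B.card) := by
      rw [← Real.log_le_iff_le_exp hpos]; exact hceil2
    have h3 : 2 * h * mB ≤ 2 * h₀ * (σ * K ^ 2) := by
      rw [hmBm]
      calc 2 * h * (B.card * m) = 2 * (h * B.card) * m := by ring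
        _ ≤ 2 * h₀ * (σ * K ^ 2) :=
          mul_le_mul (mul_le_mul_of_nonneg_left hwin zero_le_two) hmK hm0 (mul_nonneg zero_le_two hh₀0.le)
    have h4 : 2 * h * (lam ^ 2 * D ^ 2 / 2) * B.card ≤ h₀ * (lam ^ 2 * D ^ 2) := by
      calc 2 * h * (lam ^ 2 * D ^ 2 / 2) * B.card = (h * B.card) * (lam ^ 2 * D ^ 2) := by ring
        _ ≤ h₀ * (lam ^ 2 * D ^ 2) := mul_le_mul_of_nonneg_right hwin (by positivity)
    rw [e1, hE₀]
    calc Real.exp (2 * h * mB) * ∫ Y, Real.exp (-(2 * h) * H Y) ∂γ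
        ≤ Real.exp (2 * h₀ * (σ * K ^ 2)) * Real.exp (h₀ * (lam ^ 2 * D ^ 2)) :=
          mul_le_mul (Real.exp_le_exp.2 h3) (h2.trans (Real.exp_le_exp.2 h4)) hpos.le (Real.exp_pos _).le
      _ = Real.exp (2 * h₀ * (σ * K ^ 2) + h₀ * (lam ^ 2 * D ^ 2)) := by rw [Real.exp_add]
  -- (iv) the one-sided moment bound
  have key := log_integral_exp_neg_mul_le_of_moments (μ := γ) (Z := fun Y => H Y - mB) (h := h) hZ0 hZ1 hZ2 hZ4 hE1 hE2
  -- (v) assemble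
  have hconv : ∫ Y, Real.exp (-(h * (H Y - mB))) ∂γ = Real.exp (h * mB) * ∫ Y, Real.exp (-h * H Y) ∂γ := by
    rw [← integral_const_mul]
    exact integral_congr_ae (ae_of_all _ fun Y => eE h Y)
  have hpos1 : 0 < ∫ Y, Real.exp (-h * H Y) ∂γ := integral_exp_pos iE1'
  have hlog : Real.log (∫ Y, Real.exp (-(h * (H Y - mB))) ∂γ) = h * mB + Real.log (∫ Y, Real.exp (-h * H Y) ∂γ) := by
    rw [hconv, Real.log_mul (Real.exp_pos _).ne' hpos1.ne', Real.log_exp]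
  have hroot4 : (∫ Y, (H Y - mB) ^ 4 ∂γ) ^ (1 / 2 : ℝ) ≤ 81 * M₂ * B.card := by
    have h1 : (∫ Y, (H Y - mB) ^ 4 ∂γ) ^ (1 / 2 : ℝ) ≤ ((81 * M₂ * B.card) ^ 2) ^ (1 / 2 : ℝ) :=
      Real.rpow_le_rpow (integral_nonneg fun Y => by positivity) hZ4le (by norm_num)
    refine h1.trans (le_of_eq ?_)
    rw [← Real.sqrt_eq_rpow, Real.sqrt_sq (by positivity)]
  have hrootE : (∫ Y, Real.exp (-(2 * h * (H Y - mB))) ∂γ) ^ (1 / 2 : ℝ) ≤ E₀ ^ (1 / 2 : ℝ) :=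
    Real.rpow_le_rpow (integral_nonneg fun Y => (Real.exp_pos _).le) hE2le (by norm_num)
  have hprod : (∫ Y, (H Y - mB) ^ 4 ∂γ) ^ (1 / 2 : ℝ) * (∫ Y, Real.exp (-(2 * h * (H Y - mB))) ∂γ) ^ (1 / 2 : ℝ) ≤
      81 * M₂ * B.card * E₀ ^ (1 / 2 : ℝ) :=
    mul_le_mul hroot4 hrootE (Real.rpow_nonneg (integral_nonneg fun Y => (Real.exp_pos _).le) _)
      (mul_nonneg (mul_nonneg (by norm_num) hM₂0) hcard0)
  have hfinal : h ^ 2 / 2 * (∫ Y, (H Y - mB) ^ 2 ∂γ +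
      (∫ Y, (H Y - mB) ^ 4 ∂γ) ^ (1 / 2 : ℝ) * (∫ Y, Real.exp (-(2 * h * (H Y - mB))) ∂γ) ^ (1 / 2 : ℝ)) ≤
      M * h ^ 2 * (B.card : ℝ) := by
    have hh2 : 0 ≤ h ^ 2 / 2 := by positivity
    calc _ ≤ h ^ 2 / 2 * (M₂ * (B.card : ℝ) + 81 * M₂ * B.card * E₀ ^ (1 / 2 : ℝ)) :=
          mul_le_mul_of_nonneg_left (add_le_add hZ2le hprod) hh2
      _ = M * h ^ 2 * (B.card : ℝ) := by rw [hM]; ring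
  have hmain := key.trans hfinal
  rw [hlog] at hmain
  show Real.log (∫ Y, Real.exp (-h * H Y) ∂γ) ≤ -h * mB + M * h ^ 2 * (B.card : ℝ)
  linarith only [hmain]

end Window

end Summit.QuantumFields.YangMills.Cruxes.SourcedPressureIncrement.Birth
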